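/-
Copyright: lit-balaban Phase-2 proof seat p30 (gen 9).  Statement-level skeleton of a published paper; no proof claims beyond what
the kernel checks below.
-/
import Literature.MathematicalPhysics.QuantumFieldTheory.BalabanImbrieJaffe1984to88.BIJ85ResidualMinimizer
import Literature.MathematicalPhysics.QuantumFieldTheory.BalabanImbrieJaffe1984to88.BIJ88Ineq217Ineq722Torus

/-!
# [BalabanImbrieJaffe1985] (4.2.6)/(5.2.12) on EXACT unit fields: `f_k = ∂^ηH_kB` for `f = ∂B`, and its size from the ∇H member of (7.2.2)

T. Bałaban, J. Imbrie, A. Jaffe, *Renormalization of the Higgs model: minimizers, propagators and the stability of mean field theory*,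
Commun. Math. Phys. **97** (1985) 299–329 [BalabanImbrieJaffe1985].  Row **C1.Eq7.3.1-7.3.2** of the lit-balaban skeleton, the residual
link (located input `K_R` of p33's `BIJ85Claim73Residual`): the size of the residual field (4.2.6) `f_k = (I − ∂G_{k,Ax}∂^*)Q^{e*}_kf`
(p33's `BIJ85Eq454PlaqResidual.resE`, Euclidean encoding `resE = √w·f_k`) on the EXACT part `f = ∂B` of a unit plaquette field.

THE PRINTED TEXT, verbatim.  p. 326 [PDF 28]: *"(7.3.1) ensures that |u_k(∂p) − 1| ≤ O(1)𝓅(e_k)e_kη² … by change of gauge u_k can be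
transformed in a local region Λ into a configuration of the form exp[ie_kηA], where A is smooth and small"*; the mechanism is
[BalabanImbrieJaffe1988] p. 319 (6.1.5) *"∂H_k = (I − ∂G_{k,Ax}∂^*)Q^{e*}_k∂"*, on the tori `resE(∂B) = ∂H_kB` (tree: p33 g7
`BIJ85ResidualMinimizer.resE_dOne_eq_curlOp_HkE`, equivalently r16/p30 `BIJ88Eq551Torus.eq615_torus_DkE`), together with the kernel
representation (7.2.1) and the ∇H member of (7.2.2) p. 325 (tree: p08 `BIJ88Ineq217GradKernel.curlHk_apply_eq_sum`,
`BIJ88Ineq217Ineq722Torus.hK_of_kernelBounds` / `exists_hK_of_ineq722`).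

WHAT IS PROVED (0 `sorry`, theorems only, no new named fact; standing range `k ≤ m + K`, `2 ≤ d`, `w > 0`, `c ≠ 0`).
* §1 pointwise kernel form of `resE(∂B) = ∂^{c}H_kB`: `resE(∂B)(p) = √w·Σ_b (∂^{c}H_ke_b)(p)·B(b)` (`resE_dOne_apply`).
* §2 **`abs_resE_dOne_le`**: a kernel bound `|(∂^{c}H_ke_b)(p)| ≤ K(p; b)` and a weight `|B(b)| ≤ β(b)` give
  `|resE(∂B)(p)| ≤ √w·Σ_b K(p; b)β(b)`.
* §3 the row sums with QUADRATIC GROWTH WEIGHTS (the potentials of the gauge of p. 326, `BIJ85UnitTorusHodge`, grow like `(1 + |b₋ − x₀|₁)²`):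
  `(1 + t)²e^{−δt} ≤ (1 + 4/δ)²e^{−δt/2}` and `Σ_{b∈T^{(k)}} (1 + |x₀ − b₋|₁)²e^{−δ|x₀ − b₋|₁} ≤ (1 + 4/δ)²·d·(2(1 + 2/δ))^d` uniformly in the
  volume (`sum_bond_growth_exp_le`, from `B3TorusRadialSums.sum_exp_neg_tdist_le`).
* §4 **`abs_resE_dOne_le_of_growth`**: the kernel shape of the ∇H member of (7.2.2), `|(∂^{c}H_ke_b)(p)| ≤ Me^{−δ|x_k(p) − b₋|₁}`, and a potential
  with `|B(b)| ≤ C_B(1 + |b₋ − x_k(p)|₁)²` give `|resE(∂B)(p)| ≤ √w·M·C_B·(1 + 4/δ)²·d·(2(1 + 2/δ))^d`.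
HONEST SCOPE.  The exact part only; the constant (harmonic) part of a closed unit field and the assembly with the typed (7.2.2) are the sibling
files `BIJ85ResidualConstants` / `BIJ85ResidualSupBound` of this seat.  statement-level skeleton of published theorems with citation tags;
proofs where landed; nothing here is a claim about the Yang–Mills mass gap.  Unit `lit-balaban-p30` (literature-prover-lit-balaban-p30-g9-0),
2026-08-21.
-/

open scoped BigOperators RealInnerProductSpace

namespace Literature.MathematicalPhysics.QuantumFieldTheory.BalabanImbrieJaffe1984to88.BIJ85ResidualExact

open Balaban1983to89 hiding Site Plaq
open Balaban1983to89.LatticeFieldCalculus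
open Balaban1983to89.B3TorusRadialSums (sum_exp_neg_tdist_le)
open BIJ85AxialPropagator411 BIJ85Prop521Torus BIJ85Sigma421Torus BIJ85Eq611Torus BIJ85Prop522Torus BIJ85Sigma422Eta
open BIJ85Eq454PlaqResidual (resE)
open BIJ85ResidualMinimizer (resE_dOne_eq_curlOp_HkE)
open BIJ88Ineq217GradKernel (curlHk_apply_eq_sum)
open BIJ85GaugeFunction5113 (blk)
-- inside this namespace the bare `Site`/`Plaq` are the `ℤ^d` carriers of the QFT root; the torus ones are renamed:
open Balaban1983to89 renaming Site → TSite, Plaq → TPlaq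

noncomputable section

variable {P : Params}

/-! ## §1  `resE(∂B) = ∂^{c}H_kB` pointwise, as a kernel sum ((4.2.6) on exact fields is (6.1.5) and (7.2.1)) -/

/-- Components of p09's weighted curl: `curlOp w c v p = √w·(∂^{c}v)(p)`. [cite: BalabanImbrieJaffe1985, (4.1.1) p.309] -/
theorem curlOp_apply' (w c : ℝ) (v : BondSpace P) (p : TPlaq P 0) :
    curlOp (P := P) w c v p = Real.sqrt w * curl c (WithLp.ofLp v) p := rfl

/-- **(7.2.1) for the residual field of an exact unit field**: `resE(∂B)(p) = √w·Σ_{b∈T^{(k)}} (∂^{c}H_ke_b)(p)·B(b)` — the kernel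
representation of the Landau minimizer (p08's `curlHk_apply_eq_sum`). [cite: BalabanImbrieJaffe1985, (7.2.1) p.325] -/
theorem resE_dOne_apply (hd : 2 ≤ P.d) {k : ℕ} (hk : k ≤ P.m + P.K) {c : ℝ} (hc : c ≠ 0) {w : ℝ} (hw : 0 < w)
    (B : PBond P k → ℝ) (p : TPlaq P 0) :
    resE hd w c k (dOne P k c (toEj P k B)) p =
      Real.sqrt w * ∑ b, curl c (WithLp.ofLp (HkE P w c k (toEj P k (Pi.single b 1)))) p * B b := by
  rw [resE_dOne_eq_curlOp_HkE hd hk hc hw, curlOp_apply', curlHk_apply_eq_sum]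

/-! ## §2  A kernel bound and a weight on the potential bound the residual field -/

/-- **`|resE(∂B)(p)| ≤ √w·Σ_b K(p; b)·β(b)`** whenever `|(∂^{c}H_ke_b)(p)| ≤ K(p; b)` and `|B(b)| ≤ β(b)`.
[cite: BalabanImbrieJaffe1985, (7.2.2) p.325] -/
theorem abs_resE_dOne_le (hd : 2 ≤ P.d) {k : ℕ} (hk : k ≤ P.m + P.K) {c : ℝ} (hc : c ≠ 0) {w : ℝ} (hw : 0 < w)
    {K : TPlaq P 0 → PBond P k → ℝ}
    (hK : ∀ (p : TPlaq P 0) (b : PBond P k), |curl c (WithLp.ofLp (HkE P w c k (toEj P k (Pi.single b 1)))) p| ≤ K p b)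
    {B β : PBond P k → ℝ} (hB : ∀ b, |B b| ≤ β b) (p : TPlaq P 0) :
    |resE hd w c k (dOne P k c (toEj P k B)) p| ≤ Real.sqrt w * ∑ b, K p b * β b := by
  rw [resE_dOne_apply hd hk hc hw, abs_mul, abs_of_nonneg (Real.sqrt_nonneg w)]
  refine mul_le_mul_of_nonneg_left ?_ (Real.sqrt_nonneg w)
  refine (Finset.abs_sum_le_sum_abs _ _).trans (Finset.sum_le_sum fun b _ => ?_)
  rw [abs_mul]
  exact mul_le_mul (hK p b) (hB b) (abs_nonneg _) ((abs_nonneg _).trans (hK p b))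

/-! ## §3  Row sums with quadratic growth weights -/

/-- kernel: `(1 + t)²e^{−δt} ≤ (1 + 4/δ)²e^{−δt/2}` for `t ≥ 0`, `δ > 0` (`1 + t ≤ (1 + 4/δ)(1 + δt/4) ≤ (1 + 4/δ)e^{δt/4}`).
[cite: BalabanImbrieJaffe1985, (7.2.2) p.325] -/
theorem one_add_sq_mul_exp_le {δ t : ℝ} (hδ : 0 < δ) (ht : 0 ≤ t) :
    (1 + t) ^ 2 * Real.exp (-δ * t) ≤ (1 + 4 / δ) ^ 2 * Real.exp (-(δ / 2) * t) := by
  have h1 : 1 + t ≤ (1 + 4 / δ) * Real.exp (δ * t / 4) := by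
    have h2 : 1 + δ * t / 4 ≤ Real.exp (δ * t / 4) := by
      have := Real.add_one_le_exp (δ * t / 4); linarith
    have h3 : 1 + t ≤ (1 + 4 / δ) * (1 + δ * t / 4) := by
      have h4 : (1 + 4 / δ) * (1 + δ * t / 4) = 1 + t + (4 / δ + δ * t / 4) := by field_simp; ring
      rw [h4]
      have : 0 ≤ 4 / δ + δ * t / 4 := by positivity
      linarith
    exact h3.trans (mul_le_mul_of_nonneg_left h2 (by positivity))
  have h5 : (1 + t) ^ 2 ≤ (1 + 4 / δ) ^ 2 * Real.exp ((δ / 2) * t) := by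
    have h6 := pow_le_pow_left₀ (by positivity) h1 2
    rw [mul_pow, ← Real.exp_nat_mul] at h6
    refine h6.trans (le_of_eq ?_)
    congr 2
    push_cast
    ring
  calc (1 + t) ^ 2 * Real.exp (-δ * t) ≤ (1 + 4 / δ) ^ 2 * Real.exp ((δ / 2) * t) * Real.exp (-δ * t) :=
        mul_le_mul_of_nonneg_right h5 (Real.exp_nonneg _)
    _ = (1 + 4 / δ) ^ 2 * Real.exp (-(δ / 2) * t) := by
        rw [mul_assoc, ← Real.exp_add]
        congr 2
        ring

/-- `|x − y|₁` is symmetric. [cite: BalabanImbrieJaffe1985, (7.2.2) p.325] -/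
theorem tdist_comm {j : ℕ} (x y : TSite P j) : x.tdist y = y.tdist x := by
  unfold Balaban1983to89.Site.tdist
  exact Finset.sum_congr rfl fun μ _ => min_comm _ _

/-- **Uniform row sums with quadratic growth weights over the unit bonds of `T^{(k)}`**:
`Σ_{b∈T^{(k)}} (1 + |x₀ − b₋|₁)²e^{−δ|x₀ − b₋|₁} ≤ (1 + 4/δ)²·d·(2(1 + (δ/2)⁻¹))^d` for every site `x₀` and every `δ > 0`, uniformly in the
volume and in `k` (bonds = sites × directions; `B3TorusRadialSums.sum_exp_neg_tdist_le`). [cite: BalabanImbrieJaffe1985, (7.2.2) p.325] -/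
theorem sum_bond_growth_exp_le {k : ℕ} {δ : ℝ} (hδ : 0 < δ) (x₀ : TSite P k) :
    ∑ b : PBond P k, (1 + (x₀.tdist b.src : ℝ)) ^ 2 * Real.exp (-δ * (x₀.tdist b.src : ℝ)) ≤
      (1 + 4 / δ) ^ 2 * ((P.d : ℝ) * (2 * (1 + (δ / 2)⁻¹)) ^ P.d) := by
  have hterm : ∀ b : PBond P k, (1 + (x₀.tdist b.src : ℝ)) ^ 2 * Real.exp (-δ * (x₀.tdist b.src : ℝ)) ≤
      (1 + 4 / δ) ^ 2 * Real.exp (-(δ / 2) * (x₀.tdist b.src : ℝ)) :=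
    fun b => one_add_sq_mul_exp_le hδ (Nat.cast_nonneg _)
  refine (Finset.sum_le_sum fun b _ => hterm b).trans ?_
  rw [← Finset.mul_sum]
  refine mul_le_mul_of_nonneg_left ?_ (by positivity)
  rw [← Fintype.sum_equiv (LatticeFieldCalculus.bondEquiv (P := P) (j := k))
    (fun q : TSite P k × Fin P.d => Real.exp (-(δ / 2) * (x₀.tdist q.1 : ℝ))) _ (fun q => rfl), Fintype.sum_prod_type]
  simp only [Finset.sum_const, Finset.card_univ, Fintype.card_fin, nsmul_eq_mul]
  rw [← Finset.mul_sum]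
  refine mul_le_mul_of_nonneg_left ?_ (Nat.cast_nonneg _)
  refine le_trans (le_of_eq (Finset.sum_congr rfl fun y _ => by rw [neg_mul])) (sum_exp_neg_tdist_le (half_pos hδ) x₀)

/-! ## §4  The exact part of the residual field, bounded by the ∇H member of (7.2.2) -/

/-- **THE SIZE OF `f_k` ON THE EXACT PART OF A UNIT FIELD, GAUGE OF p. 326**: if the kernel of `∂^{c}H_k` obeys the shape of the ∇H member of
(7.2.2), `|(∂^{c}H_ke_b)(p)| ≤ Me^{−δ|x_k(p) − b₋|₁}` (`x_k(p)` = the `k`-block `blk k p.src` of the plaquette, `M ≥ 0`, `δ > 0`), and the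
potential is small near `x_k(p)` with quadratic growth, `|B(b)| ≤ C_B(1 + |b₋ − x_k(p)|₁)²` (`C_B ≥ 0`), then
`|resE(∂B)(p)| ≤ √w·M·C_B·(1 + 4/δ)²·d·(2(1 + 2/δ))^d` — a constant independent of `k` and of the volume.
[cite: BalabanImbrieJaffe1985, (7.3.2) p.326] -/
theorem abs_resE_dOne_le_of_growth (hd : 2 ≤ P.d) {k : ℕ} (hk : k ≤ P.m + P.K) {c : ℝ} (hc : c ≠ 0) {w : ℝ} (hw : 0 < w)
    {M δ : ℝ} (hM : 0 ≤ M) (hδ : 0 < δ)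
    (hK : ∀ (p : TPlaq P 0) (b : PBond P k), |curl c (WithLp.ofLp (HkE P w c k (toEj P k (Pi.single b 1)))) p| ≤
      M * Real.exp (-δ * ((blk k p.src).tdist b.src : ℝ)))
    (p : TPlaq P 0) {B : PBond P k → ℝ} {CB : ℝ} (hCB : 0 ≤ CB)
    (hB : ∀ b : PBond P k, |B b| ≤ CB * (1 + (b.src.tdist (blk k p.src) : ℝ)) ^ 2) :
    |resE hd w c k (dOne P k c (toEj P k B)) p| ≤
      Real.sqrt w * (M * CB * ((1 + 4 / δ) ^ 2 * ((P.d : ℝ) * (2 * (1 + (δ / 2)⁻¹)) ^ P.d))) := by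
  have h1 := abs_resE_dOne_le hd hk hc hw hK hB p
  refine h1.trans (mul_le_mul_of_nonneg_left ?_ (Real.sqrt_nonneg w))
  have h2 : ∀ b : PBond P k, M * Real.exp (-δ * ((blk k p.src).tdist b.src : ℝ)) * (CB * (1 + (b.src.tdist (blk k p.src) : ℝ)) ^ 2) =
      M * CB * ((1 + ((blk k p.src).tdist b.src : ℝ)) ^ 2 * Real.exp (-δ * ((blk k p.src).tdist b.src : ℝ))) := fun b => by
    rw [tdist_comm b.src]; ring
  simp only [h2]
  rw [← Finset.mul_sum]
  exact mul_le_mul_of_nonneg_left (sum_bond_growth_exp_le hδ (blk k p.src)) (mul_nonneg hM hCB)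

end

end Literature.MathematicalPhysics.QuantumFieldTheory.BalabanImbrieJaffe1984to88.BIJ85ResidualExact
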